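import Summits.QuantumFields.YangMills.Theorems.FluctuationComparisonRegPrIntLS2BetaPairingOfTangentLetters
import Summits.QuantumFields.YangMills.Theorems.FluctuationComparisonRegPrIntLS2BetaStrataOfLetters
import HarnessLib

/-!
# S2β ∕ GAP♯∘ strata residue (H′) — THE GAUGE-CONDITIONED PAIRING LANE (v3): (F-ax) ⟸ «CRIT-ax» ∧ (BKG), and «CRIT-ax» ⟸ «MULT♭-ax»
# = CRIT-m♮ ∧ MULT♮ ∧ AVG₂♭-ax, for an ARBITRARY gauge-condition predicate `Ax` (the twins of ✓`…PairingOfTangentLetters` ∕ ✓`…CritPairOfMultiplier`)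

Cell `ym3-torus` (YM ladder rung R3 = continuum `SU(2)` Yang–Mills on the three-torus — a RUNG: NOT d = 4, NOT infinite volume,
NOT a mass gap, NOT Clay).  Width seat «width 16» `ym3-torus-px16` (gen 21), FREE px helper on crux `stmt-QuantumFields-20520`
(`FluctuationComparisonRegPrIntL`), count-neutral, DEFINITION-FREE, default heartbeats.

WHY.  FINDING #2 of this seat (bus 12:31Z): bounds asked at EVERY argmin ∕ field pair (✓p822837's «CRIT♮», ✓p822876's AVG₂♭, ✓p821904's (F♮))
fail at pure-gauge pairs over a smooth-gauged background at large depth (`−LIN ≈ REL ≍ N⁻²d²` there).  The letters of record (v3,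
✓∕⧗`…StrataOfAxialLetters`) carry a gauge condition `Ax F J K hJK U U₀` on the pair; this file threads `Ax →` through the pairing lane, proofs unchanged:
* ★★★ `pairingAx_of_critAx (G) (Ax) (hCrit) (hBkg)` — (F-ax) VERBATIM (the `hF` of `gapStratum_of_axialLetters`) ⟸ «CRIT-ax»: prefix,
  `∃ γ₁ > 0, ∃ C_c ≥ 0, ∀ … ∀ U₀ ∈ argmin, ∀ U ∈ fibre ∩ histGood, Ax(U,U₀) → |DA(U₀)[ξ(U,U₀)]| ≤ C_c·θ_J·(N⁻²·d² + REL)` (`DA` = ✓`…PairingTangentSplit`'s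
  explicit first variation) ∧ (BKG) (px5 g22 ✓`…BackgroundLetterOfThm1Pair`, unchanged); (T♮) = ✓`tangentSplit` (a theorem, all pairs).
* ★★★ `critAx_of_multAx (G) (Ax) (hMult)` — «CRIT-ax» ⟸ «MULT♭-ax»: prefix, `∃ γ₁ > 0, ∃ C_λ C_M ≥ 0, ∀ … ∀ U₀ ∈ argmin, ∃ DM λ,`
  `(∀ ζ, DA(U₀)[ζ] = λ (DM ζ))` (CRIT-m♮ — a statement about `U₀` alone, px5 g22's (α)✓(β)✓ lane) `∧ (∀ v, |λ v| ≤ C_λ·θ_J·N⁻¹·Σ_B‖v_B‖)` (MULT♮)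
  `∧ ∀ U ∈ fibre ∩ histGood, Ax(U,U₀) → Σ_B‖(DM ξ)_B‖ ≤ C_M·(N⁻¹·d² + N·REL)` (AVG₂♭-ax — now asked on gauge-fixed pairs only, px10 g23's lane).

HONEST SCOPE.  DOORS over HYPOTHESIS texts; nothing of Bałaban's analysis is asserted or proved; «CRIT-ax», «MULT♭-ax», (BKG at `L = 3`), (D-ax),
`hIrr`, `hA`, GAP♯∘ (`stub_uniformFibreGapOrbit`), S2β, the five registered stubs of `Lines/semiclassical_s2beta.lean` (3732b7df), crux 20520, 19936,
19200 and `YM3TorusSU2` are NOT proved; no registered stub is closed; the Yang–Mills mass gap is NOT proved.  Sorry-free, axioms standard.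

References: T. Bałaban, CMP **102** (1985) 277–309 [Balaban1985Variational] (Thm 1 (8)–(10) p.279; (34) p.283); CMP **109** (1987) 249–301
[Balaban1987RG1] ((0.21)–(0.22) p.256); CMP **122** (1989) 175–202 [Balaban1989LargeFieldI] ((1.77) p.194); CMP **102** (1985) 255–275
[Balaban1985UV3] ((7) p.257).
-/

set_option autoImplicit false

noncomputable section

open Set Function
open scoped Matrix.Norms.L2Operator RealInnerProductSpace
open Literature.MathematicalPhysics.QuantumLattice (su2Quat)
open Literature.MathematicalPhysics.QuantumFieldTheory.Balaban1983to89
open Literature.MathematicalPhysics.QuantumFieldTheory.Balaban1983to89.T4Continuum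
open Literature.MathematicalPhysics.QuantumFieldTheory.Balaban1983to89.T3ContinuumYM3Torus
open Literature.MathematicalPhysics.QuantumFieldTheory.Balaban1983to89.T3UnitLawDensityEML (ℰp)
open Literature.MathematicalPhysics.QuantumFieldTheory.Balaban1983to89.T3UnitScaleTilt
open Literature.MathematicalPhysics.QuantumFieldTheory.Balaban1983to89.T3TiltDescent
open Literature.MathematicalPhysics.QuantumFieldTheory.Balaban1983to89.T3Thresholds (exists_gamma_forall_θBal_le)
open Literature.MathematicalPhysics.QuantumFieldTheory.Balaban1983to89.T3MinimiserStabilityReduction (θBal_pos)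
open Literature.MathematicalPhysics.QuantumFieldTheory.Balaban1983to89.T3ConstrainedMinimiser (fibre)
open Literature.MathematicalPhysics.QuantumFieldTheory.Balaban1983to89.T3PrintedRegularMinimiser
open Literature.MathematicalPhysics.QuantumFieldTheory.Balaban1983to89.T3PrintedRegularOrbits
open Literature.MathematicalPhysics.QuantumFieldTheory.Balaban1983to89.T4ExpWindowSmallField (imVec)
open Literature.MathematicalPhysics.QuantumFieldTheory.Balaban1983to89.B15Prop1ChartSU2 (adSU2)
open Summit.QuantumFields.YangMills.Theorems.FluctuationComparisonRegPrIntLS2BetaPairingTangentSplit (tangentSplit)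

namespace Summit.QuantumFields.YangMills.Theorems.FluctuationComparisonRegPrIntLS2BetaPairingOfAxialLetters

open Summit.QuantumFields.YangMills.Theorems.FluctuationComparisonRegPrIntLS2BetaPairingOfTangentLetters (neg_lin_le_of_critPair)

/-! ## §1 (F-ax) from «CRIT-ax» and (BKG) -/

/-- ★★★ **(F-ax) «PAIRING ON GAUGE-FIXED PAIRS» FROM «CRIT-ax» AND (BKG)**, arbitrary guard `G` and gauge condition `Ax`; conclusion = the `hF` input of
✓∕⧗`…StrataOfAxialLetters.gapStratum_of_axialLetters` VERBATIM. [cite: Balaban1985Variational, Thm 1 (8)-(10) p.279, (34) p.283; Balaban1987RG1, (0.21)-(0.22) p.256] -/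
theorem pairingAx_of_critAx
    (G : (F : T3Family) → (J : ℕ) → GaugeField (F.P J) 0 (Matrix.specialUnitaryGroup (Fin 2) ℂ) → Prop)
    (Ax : (F : T3Family) → (J K : ℕ) → (hJK : J ≤ K) → GaugeField (F.P K) 0 (Matrix.specialUnitaryGroup (Fin 2) ℂ) →
      GaugeField (F.P K) 0 (Matrix.specialUnitaryGroup (Fin 2) ℂ) → Prop)
    (hCrit : ∀ (L : ℕ), ∃ c₀ : ℝ, 0 < c₀ ∧ c₀ ≤ 1 ∧ ∀ (cw : ℝ), 0 < cw → cw ≤ c₀ → ∃ pS : ℝ, ∀ (b₀ p₀ : ℝ), 0 < b₀ → pS ≤ p₀ → 0 < p₀ → ∃ ε₁ : ℝ, 0 < ε₁ ∧ ∀ (ε₀ : ℝ), 0 < ε₀ → ε₀ ≤ ε₁ →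
    ∃ γ₁ : ℝ, 0 < γ₁ ∧ ∃ C_c : ℝ, 0 ≤ C_c ∧ ∀ (F : T3Family) (γ : ℝ), F.L = L → 0 < γ → γ ≤ γ₁ →
      ∀ (J K : ℕ) (hJK : J ≤ K) (V : GaugeField (F.P J) 0 (Matrix.specialUnitaryGroup (Fin 2) ℂ)), PlaqSmall (θBal F.L γ (cw * b₀) p₀ J) V →
        G F J V →
        ∀ U₀ ∈ {U' : GaugeField (F.P K) 0 (Matrix.specialUnitaryGroup (Fin 2) ℂ) | U' ∈ fibre F ℰp J K hJK V ∧ U' ∈ histGood F ℰp (θBal F.L γ b₀ p₀) K J ∧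
            wilsonAction4 U' = minActionRegPr F J K hJK ε₀ V},
        ∀ U ∈ fibre F ℰp J K hJK V, U ∈ histGood F ℰp (θBal F.L γ b₀ p₀) K J →
          Ax F J K hJK U U₀ →
          |(∑ p : Plaq (F.P K) 0, inner ℝ (imVec (su2Quat (GaugeField.plaqHol U₀ p)))
              (adSU2 (GaugeField.plaqHol U₀ p)⁻¹ (imVec (su2Quat (U ⟨p.src, p.μ⟩ * (U₀ ⟨p.src, p.μ⟩)⁻¹))) +
                adSU2 ((GaugeField.plaqHol U₀ p)⁻¹ * U₀ ⟨p.src, p.μ⟩) (imVec (su2Quat (U ⟨p.src.shift p.μ, p.ν⟩ * (U₀ ⟨p.src.shift p.μ, p.ν⟩)⁻¹))) -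
                adSU2 ((GaugeField.plaqHol U₀ p)⁻¹ * U₀ ⟨p.src, p.μ⟩ * U₀ ⟨p.src.shift p.μ, p.ν⟩ * (U₀ ⟨p.src.shift p.ν, p.μ⟩)⁻¹)
                  (imVec (su2Quat (U ⟨p.src.shift p.ν, p.μ⟩ * (U₀ ⟨p.src.shift p.ν, p.μ⟩)⁻¹))) -
                imVec (su2Quat (U ⟨p.src, p.ν⟩ * (U₀ ⟨p.src, p.ν⟩)⁻¹))))| ≤
            C_c * θBal F.L γ b₀ p₀ J * (((F.L : ℝ)⁻¹) ^ (2 * (K - J)) * ∑ ℓ : PBond (F.P K) 0, dist1 (U ℓ * (U₀ ℓ)⁻¹) ^ 2 +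
              ∑ p : Plaq (F.P K) 0, (1 - reTr ((GaugeField.plaqHol U₀ p)⁻¹ * GaugeField.plaqHol U p))))
    (hBkg : ∀ (L : ℕ), ∃ c₀ : ℝ, 0 < c₀ ∧ c₀ ≤ 1 ∧ ∀ (cw : ℝ), 0 < cw → cw ≤ c₀ → ∃ pS : ℝ, ∀ (b₀ p₀ : ℝ), 0 < b₀ → pS ≤ p₀ → 0 < p₀ → ∃ ε₁ : ℝ, 0 < ε₁ ∧ ∀ (ε₀ : ℝ), 0 < ε₀ → ε₀ ≤ ε₁ →
    ∃ γ₁ : ℝ, 0 < γ₁ ∧ ∃ C₁ : ℝ, 0 ≤ C₁ ∧ ∀ (F : T3Family) (γ : ℝ), F.L = L → 0 < γ → γ ≤ γ₁ →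
      ∀ (J K : ℕ) (hJK : J ≤ K) (V : GaugeField (F.P J) 0 (Matrix.specialUnitaryGroup (Fin 2) ℂ)), PlaqSmall (θBal F.L γ (cw * b₀) p₀ J) V →
        G F J V →
        ∀ U₀ ∈ {U' : GaugeField (F.P K) 0 (Matrix.specialUnitaryGroup (Fin 2) ℂ) | U' ∈ fibre F ℰp J K hJK V ∧ U' ∈ histGood F ℰp (θBal F.L γ b₀ p₀) K J ∧
            wilsonAction4 U' = minActionRegPr F J K hJK ε₀ V},
        ∀ p : Plaq (F.P K) 0, dist1 (GaugeField.plaqHol U₀ p) ≤ C₁ * θBal F.L γ b₀ p₀ J * ((F.L : ℝ)⁻¹) ^ (2 * (K - J))) :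
    ∀ (L : ℕ), ∃ c₀ : ℝ, 0 < c₀ ∧ c₀ ≤ 1 ∧ ∀ (cw : ℝ), 0 < cw → cw ≤ c₀ → ∃ pS : ℝ, ∀ (b₀ p₀ : ℝ), 0 < b₀ → pS ≤ p₀ → 0 < p₀ → ∃ ε₁ : ℝ, 0 < ε₁ ∧ ∀ (ε₀ : ℝ), 0 < ε₀ → ε₀ ≤ ε₁ →
    ∀ (c : ℝ), 0 < c → ∃ γ₁ : ℝ, 0 < γ₁ ∧ ∀ (F : T3Family) (γ : ℝ), F.L = L → 0 < γ → γ ≤ γ₁ →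
      ∀ (J K : ℕ) (hJK : J ≤ K) (V : GaugeField (F.P J) 0 (Matrix.specialUnitaryGroup (Fin 2) ℂ)), PlaqSmall (θBal F.L γ (cw * b₀) p₀ J) V →
        G F J V →
        ∀ U₀ ∈ {U' : GaugeField (F.P K) 0 (Matrix.specialUnitaryGroup (Fin 2) ℂ) | U' ∈ fibre F ℰp J K hJK V ∧ U' ∈ histGood F ℰp (θBal F.L γ b₀ p₀) K J ∧
            wilsonAction4 U' = minActionRegPr F J K hJK ε₀ V},
        ∀ U ∈ fibre F ℰp J K hJK V, U ∈ histGood F ℰp (θBal F.L γ b₀ p₀) K J →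
          Ax F J K hJK U U₀ →
          -(∑ p : Plaq (F.P K) 0,
              inner ℝ (imVec (su2Quat (GaugeField.plaqHol U₀ p))) (imVec (su2Quat ((GaugeField.plaqHol U₀ p)⁻¹ * GaugeField.plaqHol U p))))
            ≤ c * (((F.L : ℝ)⁻¹) ^ (2 * (K - J)) * ∑ ℓ : PBond (F.P K) 0, dist1 (U ℓ * (U₀ ℓ)⁻¹) ^ 2) +
              1 / 4 * ∑ p : Plaq (F.P K) 0, (1 - reTr ((GaugeField.plaqHol U₀ p)⁻¹ * GaugeField.plaqHol U p)) := by
  intro L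
  obtain ⟨c₁, hc₁, hc₁1, H1⟩ := hCrit L
  obtain ⟨c₂, hc₂, -, H2⟩ := hBkg L
  refine ⟨min c₁ c₂, lt_min hc₁ hc₂, (min_le_left _ _).trans hc₁1, ?_⟩
  intro cw hcw hcwle
  obtain ⟨pS₁, H1⟩ := H1 cw hcw (hcwle.trans (min_le_left _ _))
  obtain ⟨pS₂, H2⟩ := H2 cw hcw (hcwle.trans (min_le_right _ _))
  refine ⟨max pS₁ pS₂, ?_⟩
  intro b₀ p₀ hb hpS hp
  obtain ⟨e₁, he₁, H1⟩ := H1 b₀ p₀ hb ((le_max_left _ _).trans hpS) hp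
  obtain ⟨e₂, he₂, H2⟩ := H2 b₀ p₀ hb ((le_max_right _ _).trans hpS) hp
  refine ⟨min e₁ e₂, lt_min he₁ he₂, ?_⟩
  intro ε₀ hε₀ hε₀le
  obtain ⟨γA, hγA, C_c, hCc, H1⟩ := H1 ε₀ hε₀ (hε₀le.trans (min_le_left _ _))
  obtain ⟨γB, hγB, C₁, hC₁, H2⟩ := H2 ε₀ hε₀ (hε₀le.trans (min_le_right _ _))
  intro c hc
  -- `γ` small enough that `θBal(J) ≤ min c ¼ ∕ (60·C₁ + C_c + 1)` (`d = 3` for the family, ✓`T3Family.P_d`)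
  obtain ⟨γc, hγc, hγc1, hθ⟩ := exists_gamma_forall_θBal_le (b₀ := b₀) (p₀ := p₀) hb hp
    (σ := min c (1 / 4) / (20 * 3 * C₁ + C_c + 1)) (by positivity)
  refine ⟨min γA (min γB γc), lt_min hγA (lt_min hγB hγc), ?_⟩
  intro F γ hFL hγ hγle J K hJK V hV hG U₀ hU₀ U hU hUg hAx
  have ha := H1 F γ hFL hγ (hγle.trans (min_le_left _ _)) J K hJK V hV hG U₀ hU₀ U hU hUg hAx
  have hbkg := H2 F γ hFL hγ (hγle.trans ((min_le_right _ _).trans (min_le_left _ _))) J K hJK V hV hG U₀ hU₀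
  have hθJ := hθ F.L F.hL.2.le γ hγ (hγle.trans ((min_le_right _ _).trans (min_le_right _ _))) J
  have hγ1 : γ ≤ 1 := (hγle.trans ((min_le_right _ _).trans (min_le_right _ _))).trans hγc1
  have hθJ0 : 0 ≤ θBal F.L γ b₀ p₀ J := (θBal_pos F.hL.2.le hγ hγ1 hb p₀ J).le
  have hN₂ : (0 : ℝ) ≤ ((F.L : ℝ)⁻¹) ^ (2 * (K - J)) := pow_nonneg (inv_nonneg.mpr (Nat.cast_nonneg _)) _
  have hθ₀0 : 0 ≤ C₁ * θBal F.L γ b₀ p₀ J * ((F.L : ℝ)⁻¹) ^ (2 * (K - J)) := mul_nonneg (mul_nonneg hC₁ hθJ0) hN₂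
  have hT := tangentSplit U U₀ hθ₀0 hbkg
  beta_reduce at hT
  have hd : ((F.P K).d : ℝ) = 3 := by exact_mod_cast T3Family.P_d F K
  rw [hd] at hT
  have hS : (0 : ℝ) ≤ ∑ ℓ : PBond (F.P K) 0, dist1 (U ℓ * (U₀ ℓ)⁻¹) ^ 2 := Finset.sum_nonneg fun _ _ => sq_nonneg _
  have hREL : (0 : ℝ) ≤ ∑ p : Plaq (F.P K) 0, (1 - reTr ((GaugeField.plaqHol U₀ p)⁻¹ * GaugeField.plaqHol U p)) :=
    Finset.sum_nonneg fun p _ => by linarith [GaugeGroup.reTr_le_one ((GaugeField.plaqHol U₀ p)⁻¹ * GaugeField.plaqHol U p)]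
  have hpos : 0 < 20 * 3 * C₁ + C_c + 1 := by positivity
  have hσ : (20 * 3 * C₁ + C_c + 1) * θBal F.L γ b₀ p₀ J ≤ min c (1 / 4) := by
    have h1 := mul_le_mul_of_nonneg_left hθJ hpos.le
    rwa [mul_div_cancel₀ _ hpos.ne'] at h1
  have hc' : (20 * 3 * C₁ + C_c) * θBal F.L γ b₀ p₀ J ≤ c := by
    have := min_le_left c (1 / 4); nlinarith
  have hq : C_c * θBal F.L γ b₀ p₀ J ≤ 1 / 4 := by
    have := min_le_right c (1 / 4); nlinarith
  exact neg_lin_le_of_critPair hS hREL hN₂ (by norm_num) hT ha le_rfl hc' hq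

/-! ## §2 «CRIT-ax» from «MULT♭-ax» -/

/-- ★★★ **«CRIT-ax» FROM CRIT-m♮ ∧ MULT♮ ∧ AVG₂♭-ax**, arbitrary guard `G` and gauge condition `Ax`; conclusion = `pairingAx_of_critAx`'s `hCrit` VERBATIM.
[cite: Balaban1987RG1, (0.21)-(0.22) p.256; Balaban1985Variational, Thm 1 (8)-(10) p.279, (34) p.283] -/
theorem critAx_of_multAx
    (G : (F : T3Family) → (J : ℕ) → GaugeField (F.P J) 0 (Matrix.specialUnitaryGroup (Fin 2) ℂ) → Prop)
    (Ax : (F : T3Family) → (J K : ℕ) → (hJK : J ≤ K) → GaugeField (F.P K) 0 (Matrix.specialUnitaryGroup (Fin 2) ℂ) →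
      GaugeField (F.P K) 0 (Matrix.specialUnitaryGroup (Fin 2) ℂ) → Prop)
    (hMult : ∀ (L : ℕ), ∃ c₀ : ℝ, 0 < c₀ ∧ c₀ ≤ 1 ∧ ∀ (cw : ℝ), 0 < cw → cw ≤ c₀ → ∃ pS : ℝ, ∀ (b₀ p₀ : ℝ), 0 < b₀ → pS ≤ p₀ → 0 < p₀ → ∃ ε₁ : ℝ, 0 < ε₁ ∧ ∀ (ε₀ : ℝ), 0 < ε₀ → ε₀ ≤ ε₁ →
    ∃ γ₁ : ℝ, 0 < γ₁ ∧ ∃ C_lam : ℝ, 0 ≤ C_lam ∧ ∃ C_M : ℝ, 0 ≤ C_M ∧ ∀ (F : T3Family) (γ : ℝ), F.L = L → 0 < γ → γ ≤ γ₁ →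
      ∀ (J K : ℕ) (hJK : J ≤ K) (V : GaugeField (F.P J) 0 (Matrix.specialUnitaryGroup (Fin 2) ℂ)), PlaqSmall (θBal F.L γ (cw * b₀) p₀ J) V →
        G F J V →
        ∀ U₀ ∈ {U' : GaugeField (F.P K) 0 (Matrix.specialUnitaryGroup (Fin 2) ℂ) | U' ∈ fibre F ℰp J K hJK V ∧ U' ∈ histGood F ℰp (θBal F.L γ b₀ p₀) K J ∧
            wilsonAction4 U' = minActionRegPr F J K hJK ε₀ V},
        ∃ (DM : (PBond (F.P K) 0 → EuclideanSpace ℝ (Fin 3)) → (PBond (F.P J) 0 → EuclideanSpace ℝ (Fin 3)))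
          (lam : (PBond (F.P J) 0 → EuclideanSpace ℝ (Fin 3)) → ℝ),
          (∀ ζ : PBond (F.P K) 0 → EuclideanSpace ℝ (Fin 3),
            (∑ p : Plaq (F.P K) 0, inner ℝ (imVec (su2Quat (GaugeField.plaqHol U₀ p)))
              (adSU2 (GaugeField.plaqHol U₀ p)⁻¹ (ζ ⟨p.src, p.μ⟩) + adSU2 ((GaugeField.plaqHol U₀ p)⁻¹ * U₀ ⟨p.src, p.μ⟩) (ζ ⟨p.src.shift p.μ, p.ν⟩) -
                adSU2 ((GaugeField.plaqHol U₀ p)⁻¹ * U₀ ⟨p.src, p.μ⟩ * U₀ ⟨p.src.shift p.μ, p.ν⟩ * (U₀ ⟨p.src.shift p.ν, p.μ⟩)⁻¹) (ζ ⟨p.src.shift p.ν, p.μ⟩) -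
                ζ ⟨p.src, p.ν⟩)) = lam (DM ζ)) ∧
          (∀ v : PBond (F.P J) 0 → EuclideanSpace ℝ (Fin 3),
            |lam v| ≤ C_lam * θBal F.L γ b₀ p₀ J * ((F.L : ℝ)⁻¹) ^ (K - J) * ∑ B : PBond (F.P J) 0, ‖v B‖) ∧
          ∀ U ∈ fibre F ℰp J K hJK V, U ∈ histGood F ℰp (θBal F.L γ b₀ p₀) K J →
            Ax F J K hJK U U₀ →
            ∑ B : PBond (F.P J) 0, ‖DM (fun ℓ => imVec (su2Quat (U ℓ * (U₀ ℓ)⁻¹))) B‖ ≤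
              C_M * (((F.L : ℝ)⁻¹) ^ (K - J) * ∑ ℓ : PBond (F.P K) 0, dist1 (U ℓ * (U₀ ℓ)⁻¹) ^ 2 +
                (F.L : ℝ) ^ (K - J) * ∑ p : Plaq (F.P K) 0, (1 - reTr ((GaugeField.plaqHol U₀ p)⁻¹ * GaugeField.plaqHol U p)))) :
    ∀ (L : ℕ), ∃ c₀ : ℝ, 0 < c₀ ∧ c₀ ≤ 1 ∧ ∀ (cw : ℝ), 0 < cw → cw ≤ c₀ → ∃ pS : ℝ, ∀ (b₀ p₀ : ℝ), 0 < b₀ → pS ≤ p₀ → 0 < p₀ → ∃ ε₁ : ℝ, 0 < ε₁ ∧ ∀ (ε₀ : ℝ), 0 < ε₀ → ε₀ ≤ ε₁ →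
    ∃ γ₁ : ℝ, 0 < γ₁ ∧ ∃ C_c : ℝ, 0 ≤ C_c ∧ ∀ (F : T3Family) (γ : ℝ), F.L = L → 0 < γ → γ ≤ γ₁ →
      ∀ (J K : ℕ) (hJK : J ≤ K) (V : GaugeField (F.P J) 0 (Matrix.specialUnitaryGroup (Fin 2) ℂ)), PlaqSmall (θBal F.L γ (cw * b₀) p₀ J) V →
        G F J V →
        ∀ U₀ ∈ {U' : GaugeField (F.P K) 0 (Matrix.specialUnitaryGroup (Fin 2) ℂ) | U' ∈ fibre F ℰp J K hJK V ∧ U' ∈ histGood F ℰp (θBal F.L γ b₀ p₀) K J ∧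
            wilsonAction4 U' = minActionRegPr F J K hJK ε₀ V},
        ∀ U ∈ fibre F ℰp J K hJK V, U ∈ histGood F ℰp (θBal F.L γ b₀ p₀) K J →
          Ax F J K hJK U U₀ →
          |(∑ p : Plaq (F.P K) 0, inner ℝ (imVec (su2Quat (GaugeField.plaqHol U₀ p)))
              (adSU2 (GaugeField.plaqHol U₀ p)⁻¹ (imVec (su2Quat (U ⟨p.src, p.μ⟩ * (U₀ ⟨p.src, p.μ⟩)⁻¹))) +
                adSU2 ((GaugeField.plaqHol U₀ p)⁻¹ * U₀ ⟨p.src, p.μ⟩) (imVec (su2Quat (U ⟨p.src.shift p.μ, p.ν⟩ * (U₀ ⟨p.src.shift p.μ, p.ν⟩)⁻¹))) -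
                adSU2 ((GaugeField.plaqHol U₀ p)⁻¹ * U₀ ⟨p.src, p.μ⟩ * U₀ ⟨p.src.shift p.μ, p.ν⟩ * (U₀ ⟨p.src.shift p.ν, p.μ⟩)⁻¹)
                  (imVec (su2Quat (U ⟨p.src.shift p.ν, p.μ⟩ * (U₀ ⟨p.src.shift p.ν, p.μ⟩)⁻¹))) -
                imVec (su2Quat (U ⟨p.src, p.ν⟩ * (U₀ ⟨p.src, p.ν⟩)⁻¹))))| ≤
            C_c * θBal F.L γ b₀ p₀ J * (((F.L : ℝ)⁻¹) ^ (2 * (K - J)) * ∑ ℓ : PBond (F.P K) 0, dist1 (U ℓ * (U₀ ℓ)⁻¹) ^ 2 +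
              ∑ p : Plaq (F.P K) 0, (1 - reTr ((GaugeField.plaqHol U₀ p)⁻¹ * GaugeField.plaqHol U p))) := by
  intro L
  obtain ⟨c₀, hc₀, hc₀1, H⟩ := hMult L
  refine ⟨c₀, hc₀, hc₀1, ?_⟩
  intro cw hcw hcwle
  obtain ⟨pS, H⟩ := H cw hcw hcwle
  refine ⟨pS, ?_⟩
  intro b₀ p₀ hb hpS hp
  obtain ⟨ε₁, hε₁, H⟩ := H b₀ p₀ hb hpS hp
  refine ⟨ε₁, hε₁, ?_⟩
  intro ε₀ hε₀ hε₀le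
  obtain ⟨γ₁, hγ₁, C_lam, hClam, C_M, hCM, H⟩ := H ε₀ hε₀ hε₀le
  refine ⟨min γ₁ 1, lt_min hγ₁ one_pos, C_lam * C_M, mul_nonneg hClam hCM, ?_⟩
  intro F γ hFL hγ hγle J K hJK V hV hG U₀ hU₀ U hU hUg hAx
  obtain ⟨DM, lam, hcrit, hlam, hM⟩ := H F γ hFL hγ (hγle.trans (min_le_left _ _)) J K hJK V hV hG U₀ hU₀
  have hMU := hM U hU hUg hAx
  have hγ1 : γ ≤ 1 := hγle.trans (min_le_right _ _)
  have hθ0 : 0 ≤ θBal F.L γ b₀ p₀ J := (θBal_pos F.hL.2.le hγ hγ1 hb p₀ J).le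
  have hL0 : (0 : ℝ) < (F.L : ℝ) := by exact_mod_cast (show 0 < F.L by have := F.hL.2; omega)
  have hN₁ : (0 : ℝ) ≤ ((F.L : ℝ)⁻¹) ^ (K - J) := pow_nonneg (inv_nonneg.mpr hL0.le) _
  have hNN : ((F.L : ℝ)⁻¹) ^ (K - J) * (F.L : ℝ) ^ (K - J) = 1 := by
    rw [← mul_pow, inv_mul_cancel₀ hL0.ne', one_pow]
  have hN2 : ((F.L : ℝ)⁻¹) ^ (K - J) * ((F.L : ℝ)⁻¹) ^ (K - J) = ((F.L : ℝ)⁻¹) ^ (2 * (K - J)) := by rw [← pow_add, two_mul]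
  have hc := hcrit (fun ℓ => imVec (su2Quat (U ℓ * (U₀ ℓ)⁻¹)))
  beta_reduce at hc
  rw [hc]
  refine (hlam _).trans ?_
  have hcoef : 0 ≤ C_lam * θBal F.L γ b₀ p₀ J * ((F.L : ℝ)⁻¹) ^ (K - J) := mul_nonneg (mul_nonneg hClam hθ0) hN₁
  refine (mul_le_mul_of_nonneg_left hMU hcoef).trans (le_of_eq ?_)
  rw [← hN2]
  have : C_lam * θBal F.L γ b₀ p₀ J * ((F.L : ℝ)⁻¹) ^ (K - J) *
      (C_M * (((F.L : ℝ)⁻¹) ^ (K - J) * ∑ ℓ : PBond (F.P K) 0, dist1 (U ℓ * (U₀ ℓ)⁻¹) ^ 2 +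
        (F.L : ℝ) ^ (K - J) * ∑ p : Plaq (F.P K) 0, (1 - reTr ((GaugeField.plaqHol U₀ p)⁻¹ * GaugeField.plaqHol U p)))) =
      C_lam * C_M * θBal F.L γ b₀ p₀ J *
        (((F.L : ℝ)⁻¹) ^ (K - J) * ((F.L : ℝ)⁻¹) ^ (K - J) * ∑ ℓ : PBond (F.P K) 0, dist1 (U ℓ * (U₀ ℓ)⁻¹) ^ 2 +
          (((F.L : ℝ)⁻¹) ^ (K - J) * (F.L : ℝ) ^ (K - J)) * ∑ p : Plaq (F.P K) 0, (1 - reTr ((GaugeField.plaqHol U₀ p)⁻¹ * GaugeField.plaqHol U p))) := by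
    ring
  rw [this, hNN, one_mul]

end Summit.QuantumFields.YangMills.Theorems.FluctuationComparisonRegPrIntLS2BetaPairingOfAxialLetters

end
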